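import Mathlib
import Summits.ABC.ABC.Statement
import Summits.ABC.ABC.Theorems.SoloInformedWieferich

/-!
# What `ABC` says at one prime of `2^n - 1` (solo-ABC-informed, session 3)

Companion of `Summits/ABC/ABC/Theorems/SoloInformedWieferich.lean`.  For a prime `p ∣ 2^n - 1`
write `v = v_p(2^n - 1)`; for an odd prime `p` write `e_p = ord_p(2)` and
`W(p) = v_p(2^(p-1) - 1)` (the Wieferich exponent).  Three elementary statements:

* (trivial / Liouville-type bound) `p^(v-1) · rad(2^n - 1) ≤ 2^n - 1`, hence
  `(v - 1) · log p ≤ n · log 2 - log rad(2^n - 1)` and in particular `p^{W(p)} ∣ 2^{e_p} - 1`,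
  `W(p) · log p < e_p · log 2` (`soloInformed_pow_pred_mul_radical_le`,
  `soloInformed_padicValNat_two_pow_order_sub_one`, `soloInformed_wieferichExp_mul_log_lt`);
* (`ABC` on the family `(1, 2^n - 1, 2^n)`) `ABC → ∀ ε > 0, ∃ K, ∀ n, (1 - ε) · n · log 2 ≤ log rad(2^n - 1) + K`
  (`soloInformed_log_radical_mersenne_of_abc`);
* (the one-prime face) `ABC → ∀ ε > 0, ∃ K, ∀ n, ∀ p prime, p ∣ 2^n - 1 →
  (v_p(2^n - 1) - 1) · log p ≤ ε · n · log 2 + K` (`soloInformed_onePrime_of_abc`); at `n = e_p`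
  this reads `(W(p) - 1) · log p ≤ ε · e_p · log 2 + K`: a Roth-type improvement — exponent `1 ↦ ε`,
  UNIFORM in `p` — of the trivial bound, and `ABC → ∀ δ > 0, ∃ N, ∀ n ≥ N, ∀ p prime,
  p ∣ 2^n - 1 → 2^(δ n) < p → v_p(2^n - 1) = 1` (`soloInformed_squarefree_above_of_abc`: under
  `ABC` the non-squarefree part of `2^n - 1` is supported on the primes below `2^{δ n}`).

No unconditional result improving the trivial bound at a single prime, uniformly in `p`, is known
to the seat (report `run/shared/lean/ideation/ABC/solo-informed/paper/paper.md`, §2.1 (F3)–(F5)).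
[folklore]
-/

namespace Summit.ABC.ABC.Theorems

open Literature.NumberTheory.DiophantineGeometry UniqueFactorizationMonoid

/-! ### The trivial bound: `p^(v-1) · rad(m) ≤ m` -/

/-- For `m ≠ 0` and a prime `p`, `p ^ (v_p(m) - 1) * rad(m) ≤ m`
(write `m = p^v · m'` with `p ∤ m'`; then `rad(m) ∣ p · m'` when `v ≥ 1`). [folklore] -/
theorem soloInformed_pow_pred_mul_radical_le {m p : ℕ} (hm : m ≠ 0) (hp : p.Prime) :
    p ^ (padicValNat p m - 1) * radical m ≤ m := by
  rcases Nat.eq_zero_or_pos (padicValNat p m) with h0 | hpos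
  · rw [h0]
    simpa using Nat.le_of_dvd (Nat.pos_of_ne_zero hm) (radical_dvd_self (a := m))
  -- m = p^v * m', p ∤ m'
  set v := padicValNat p m with hv
  have hfac : m.factorization p = v := by rw [hv, Nat.factorization_def m hp]
  have hdecomp : p ^ v * (m / p ^ v) = m := by
    have := Nat.ordProj_mul_ordCompl_eq_self m p
    rwa [hfac] at this
  set m' := m / p ^ v with hm'
  have hm'0 : m' ≠ 0 := by
    intro h
    rw [h, mul_zero] at hdecomp
    exact hm hdecomp.symm
  have hcop : Nat.Coprime p m' := by
    have := Nat.coprime_ordCompl hp hm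
    rwa [hfac] at this
  have hcop' : Nat.Coprime (p ^ v) m' := Nat.Coprime.pow_left v hcop
  -- radical m = p * radical m'
  have hrad : radical m = p * radical m' := by
    conv_lhs => rw [← hdecomp]
    rw [radical_mul (Nat.coprime_iff_isRelPrime.mp hcop'),
      radical_pow_of_prime hp.prime hpos.ne']
    simp
  rw [hrad]
  have hradle : radical m' ≤ m' := Nat.le_of_dvd (Nat.pos_of_ne_zero hm'0) radical_dvd_self
  calc p ^ (v - 1) * (p * radical m') = p ^ (v - 1 + 1) * radical m' := by ring
    _ = p ^ v * radical m' := by rw [Nat.sub_add_cancel hpos]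
    _ ≤ p ^ v * m' := Nat.mul_le_mul_left _ hradle
    _ = m := hdecomp

/-- Logarithmic form of the trivial bound on the Mersenne family: for a prime `p` and `n ≥ 1`,
`(v_p(2^n - 1) - 1) · log p + log rad(2^n - 1) ≤ n · log 2` (natural subtraction; the statement is
trivial when `p ∤ 2^n - 1`). [folklore] -/
theorem soloInformed_padicValNat_pred_mul_log_add_log_radical_le {p n : ℕ} (hp : p.Prime) (hn : 0 < n) :
    ((padicValNat p (2 ^ n - 1) - 1 : ℕ) : ℝ) * Real.log p
      + Real.log ((radical (2 ^ n - 1) : ℕ) : ℝ) ≤ n * Real.log 2 := by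
  have hm : 2 ^ n - 1 ≠ 0 := by
    have := Nat.one_lt_two_pow hn.ne'
    omega
  have key := soloInformed_pow_pred_mul_radical_le hm hp
  have hp0 : (0 : ℝ) < p := by exact_mod_cast hp.pos
  have hr0 : (0 : ℝ) < ((radical (2 ^ n - 1) : ℕ) : ℝ) := by exact_mod_cast Nat.radical_pos _
  have hcast : ((p : ℝ) ^ (padicValNat p (2 ^ n - 1) - 1)) * ((radical (2 ^ n - 1) : ℕ) : ℝ)
      ≤ ((2 ^ n - 1 : ℕ) : ℝ) := by exact_mod_cast key
  have hlt : ((2 ^ n - 1 : ℕ) : ℝ) < (2 : ℝ) ^ n := by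
    have h1 : 1 ≤ 2 ^ n := Nat.one_le_two_pow
    rw [Nat.cast_sub h1]; push_cast; linarith
  have hprod_pos : (0 : ℝ) < ((p : ℝ) ^ (padicValNat p (2 ^ n - 1) - 1)) * ((radical (2 ^ n - 1) : ℕ) : ℝ) := by
    positivity
  have := Real.log_le_log hprod_pos (hcast.trans hlt.le)
  rw [Real.log_mul (by positivity) hr0.ne', Real.log_pow, Real.log_pow] at this
  exact_mod_cast this

/-! ### The Wieferich exponent and the order of `2` -/

/-- For an odd prime `p`, the Wieferich exponent is read off at the order of `2`:
`v_p(2^(p-1) - 1) = v_p(2^(ord_p 2) - 1)` (lifting the exponent: `p - 1 = ord_p(2) · m` with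
`0 < m < p`, so `p ∤ m`). [folklore] -/
theorem soloInformed_padicValNat_two_pow_order_sub_one {p : ℕ} (hp : p.Prime) (hp2 : p ≠ 2) :
    padicValNat p (2 ^ (p - 1) - 1) = padicValNat p (2 ^ orderOf (2 : ZMod p) - 1) := by
  haveI : Fact p.Prime := ⟨hp⟩
  have h2ne0 : (2 : ZMod p) ≠ 0 := by
    intro h
    have : p ∣ 2 := (ZMod.natCast_eq_zero_iff 2 p).mp (by exact_mod_cast h)
    have := (Nat.prime_dvd_prime_iff_eq hp Nat.prime_two).mp this
    exact hp2 this
  set e := orderOf (2 : ZMod p) with he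
  have hediv : e ∣ p - 1 := ZMod.orderOf_dvd_card_sub_one h2ne0
  have hepos : 0 < e := by
    have h2u : IsOfFinOrder (2 : ZMod p) := by
      rw [← orderOf_pos_iff]
      have : orderOf (2 : ZMod p) ∣ p - 1 := hediv
      rcases Nat.eq_zero_or_pos (orderOf (2 : ZMod p)) with h | h
      · rw [h] at this
        have hp1 : 0 < p - 1 := by have := hp.two_le; omega
        exact absurd (Nat.eq_zero_of_zero_dvd this) hp1.ne'
      · exact h
    exact orderOf_pos_iff.mpr h2u
  obtain ⟨m, hm⟩ := hediv
  have hm0 : m ≠ 0 := by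
    rintro rfl
    have := hp.two_le
    omega
  -- p ∤ m since m ≤ p - 1 < p
  have hmp : ¬ p ∣ m := by
    intro h
    have hmpos : 0 < m := Nat.pos_of_ne_zero hm0
    have hle : p ≤ m := Nat.le_of_dvd hmpos h
    have : m ≤ p - 1 := by
      calc m = 1 * m := (one_mul m).symm
        _ ≤ e * m := Nat.mul_le_mul_right m hepos
        _ = p - 1 := hm.symm
    omega
  -- p ∣ 2^e - 1
  have hpow : (2 : ZMod p) ^ e = 1 := pow_orderOf_eq_one 2
  have hdvd : p ∣ 2 ^ e - 1 := by
    have h1 : 1 ≤ 2 ^ e := Nat.one_le_two_pow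
    rw [← ZMod.natCast_eq_zero_iff, Nat.cast_sub h1]
    push_cast
    rw [hpow]; ring
  have hodd : Odd p := hp.odd_of_ne_two hp2
  have hx : ¬ p ∣ 2 ^ e := by
    intro h
    have := hp.dvd_of_dvd_pow h
    exact hp2 ((Nat.prime_dvd_prime_iff_eq hp Nat.prime_two).mp this)
  have hyx : 1 < 2 ^ e := Nat.one_lt_two_pow hepos.ne'
  have key := padicValNat.pow_sub_pow (p := p) (x := 2 ^ e) (y := 1) hodd hyx hdvd hx hm0
  rw [one_pow, ← pow_mul, ← hm, padicValNat.eq_zero_of_not_dvd hmp, add_zero] at key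
  exact key

/-- **Trivial (Liouville-type) bound on the Wieferich exponent.** For an odd prime `p`,
`W(p) · log p < ord_p(2) · log 2`, because `p^{W(p)} ∣ 2^{ord_p 2} - 1 < 2^{ord_p 2}`. [folklore] -/
theorem soloInformed_wieferichExp_mul_log_lt {p : ℕ} (hp : p.Prime) (hp2 : p ≠ 2) :
    (padicValNat p (2 ^ (p - 1) - 1) : ℝ) * Real.log p
      < (orderOf (2 : ZMod p) : ℝ) * Real.log 2 := by
  haveI : Fact p.Prime := ⟨hp⟩
  rw [soloInformed_padicValNat_two_pow_order_sub_one hp hp2]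
  set e := orderOf (2 : ZMod p) with he
  -- e > 0 and p ∣ 2^e - 1 (as above)
  have h2ne0 : (2 : ZMod p) ≠ 0 := by
    intro h
    have : p ∣ 2 := (ZMod.natCast_eq_zero_iff 2 p).mp (by exact_mod_cast h)
    exact hp2 ((Nat.prime_dvd_prime_iff_eq hp Nat.prime_two).mp this)
  have hediv : e ∣ p - 1 := ZMod.orderOf_dvd_card_sub_one h2ne0
  have hepos : 0 < e := by
    rcases Nat.eq_zero_or_pos e with h | h
    · rw [h] at hediv
      have hp1 : 0 < p - 1 := by have := hp.two_le; omega
      exact absurd (Nat.eq_zero_of_zero_dvd hediv) hp1.ne'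
    · exact h
  have hm : 2 ^ e - 1 ≠ 0 := by
    have := Nat.one_lt_two_pow hepos.ne'
    omega
  have hdvd : p ^ padicValNat p (2 ^ e - 1) ∣ 2 ^ e - 1 := pow_padicValNat_dvd
  have hle : p ^ padicValNat p (2 ^ e - 1) ≤ 2 ^ e - 1 := Nat.le_of_dvd (Nat.pos_of_ne_zero hm) hdvd
  have hlt : p ^ padicValNat p (2 ^ e - 1) < 2 ^ e := by
    have : 2 ^ e - 1 < 2 ^ e := Nat.sub_lt (by positivity) one_pos
    omega
  have hcast : ((p : ℝ)) ^ padicValNat p (2 ^ e - 1) < (2 : ℝ) ^ e := by exact_mod_cast hlt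
  have hp0 : (0 : ℝ) < p := by exact_mod_cast hp.pos
  have := Real.log_lt_log (by positivity) hcast
  rwa [Real.log_pow, Real.log_pow] at this

/-! ### `ABC` on the family `(1, 2^n - 1, 2^n)` -/

/-- **`ABC` ⟹ the radical of `2^n - 1` has exponential size `2^{(1-ε)n}`.**
`ABC → ∀ ε > 0, ∃ K, ∀ n ≥ 1, (1 - ε) · n · log 2 ≤ log rad(2^n - 1) + K`. (From
`2^n < C · (2 rad)^{1+ε}` and `1/(1+ε) ≥ 1 - ε`.) Unconditionally only
`log rad(2^n - 1) ≫ (log n)`-type and Stewart-type bounds are known. [folklore] -/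
theorem soloInformed_log_radical_mersenne_of_abc (h : _root_.ABC) :
    ∀ ε : ℝ, 0 < ε → ∃ K : ℝ, ∀ n : ℕ, 0 < n →
      (1 - ε) * n * Real.log 2 ≤ Real.log ((radical (2 ^ n - 1) : ℕ) : ℝ) + K := by
  intro ε hε
  obtain ⟨C, hC, hC'⟩ := (_root_.ABC_iff.mp h) ε hε
  refine ⟨Real.log C + (1 + ε) * Real.log 2, fun n hn => ?_⟩
  have h1 := hC' 1 (2 ^ n - 1) (2 ^ n) (soloInformed_isABCTriple_mersenne hn)
  set r : ℝ := ((radical (2 ^ n - 1) : ℕ) : ℝ) with hr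
  have hr0 : 0 < r := by rw [hr]; exact_mod_cast Nat.radical_pos _
  have hradle : ((rad 1 (2 ^ n - 1) (2 ^ n) : ℕ) : ℝ) ≤ 2 * r := by
    rw [hr]; exact_mod_cast soloInformed_rad_mersenne_le hn
  have hR0 : (0 : ℝ) ≤ ((rad 1 (2 ^ n - 1) (2 ^ n) : ℕ) : ℝ) := by positivity
  have h2 : ((2 : ℝ)) ^ n < C * (2 * r) ^ (1 + ε) := by
    calc ((2 : ℝ)) ^ n = ((2 ^ n : ℕ) : ℝ) := by push_cast; ring
      _ < C * ((rad 1 (2 ^ n - 1) (2 ^ n) : ℕ) : ℝ) ^ (1 + ε) := h1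
      _ ≤ C * (2 * r) ^ (1 + ε) := by gcongr
  -- take logarithms
  have hlog := Real.log_lt_log (by positivity) h2
  rw [Real.log_pow, Real.log_mul hC.ne' (by positivity),
    Real.log_rpow (by positivity), Real.log_mul (by norm_num) hr0.ne'] at hlog
  -- n log 2 < log C + (1+ε)(log 2 + log r)
  have hlogr : 0 ≤ Real.log r := Real.log_nonneg (by
    rw [hr]; exact_mod_cast Nat.radical_pos _)
  have hl2 : 0 < Real.log 2 := Real.log_pos (by norm_num)
  -- (1-ε) n log 2 ≤ n log 2 - ε n log 2 ≤ ... we use (1+ε) log r ≤ log r + ε log r and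
  -- ε log r ≤ ε n log 2 (since r ≤ 2^n)
  have hrle : r ≤ (2 : ℝ) ^ n := by
    have : radical (2 ^ n - 1) ≤ 2 ^ n - 1 :=
      Nat.le_of_dvd (by have := Nat.one_lt_two_pow hn.ne'; omega) radical_dvd_self
    have h' : ((radical (2 ^ n - 1) : ℕ) : ℝ) ≤ ((2 ^ n - 1 : ℕ) : ℝ) := by exact_mod_cast this
    have h'' : ((2 ^ n - 1 : ℕ) : ℝ) ≤ (2 : ℝ) ^ n := by
      rw [Nat.cast_sub Nat.one_le_two_pow]; push_cast; linarith
    rw [hr]; exact h'.trans h''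
  have hlogrle : Real.log r ≤ n * Real.log 2 := by
    have := Real.log_le_log hr0 hrle
    rwa [Real.log_pow] at this
  nlinarith [hlog, hlogr, hl2, hlogrle, hε]

/-- **The one-prime face of `ABC`.** `ABC → ∀ ε > 0, ∃ K, ∀ n ≥ 1, ∀ p` prime,
`(v_p(2^n - 1) - 1) · log p ≤ ε · n · log 2 + K`. At `n = ord_p(2)` (so `p ∣ 2^n - 1` and
`v_p(2^n - 1) = W(p)` by `soloInformed_padicValNat_two_pow_order_sub_one`) this is
`(W(p) - 1) · log p ≤ ε · ord_p(2) · log 2 + K`: a Roth-type sharpening (exponent `1 ↦ ε`), uniform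
in `p`, of the trivial bound `soloInformed_wieferichExp_mul_log_lt`. [folklore] -/
theorem soloInformed_onePrime_of_abc (h : _root_.ABC) :
    ∀ ε : ℝ, 0 < ε → ∃ K : ℝ, ∀ n : ℕ, 0 < n → ∀ p : ℕ, p.Prime →
      ((padicValNat p (2 ^ n - 1) - 1 : ℕ) : ℝ) * Real.log p ≤ ε * n * Real.log 2 + K := by
  intro ε hε
  obtain ⟨K, hK⟩ := soloInformed_log_radical_mersenne_of_abc h ε hε
  refine ⟨K, fun n hn p hp => ?_⟩
  have h1 := soloInformed_padicValNat_pred_mul_log_add_log_radical_le (p := p) hp hn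
  have h2 := hK n hn
  linarith

/-- **Under `ABC`, the non-squarefree part of `2^n - 1` lives on small primes.**
`ABC → ∀ δ > 0, ∃ N, ∀ n ≥ N, ∀ p` prime, `p ∣ 2^n - 1 → 2^{δ n} < p → v_p(2^n - 1) = 1`.
[folklore] -/
theorem soloInformed_squarefree_above_of_abc (h : _root_.ABC) :
    ∀ δ : ℝ, 0 < δ → ∃ N : ℕ, ∀ n : ℕ, N ≤ n → ∀ p : ℕ, p.Prime → p ∣ 2 ^ n - 1 →
      (2 : ℝ) ^ (δ * n) < p → padicValNat p (2 ^ n - 1) = 1 := by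
  intro δ hδ
  obtain ⟨K, hK⟩ := soloInformed_onePrime_of_abc h (δ / 2) (by positivity)
  -- choose N with K < (δ/2) N log 2
  have hl2 : 0 < Real.log 2 := Real.log_pos (by norm_num)
  obtain ⟨N, hN⟩ := exists_nat_gt (max 1 (K / (δ / 2 * Real.log 2)))
  refine ⟨N, fun n hn p hp hpd hbig => ?_⟩
  haveI : Fact p.Prime := ⟨hp⟩
  have hN1r : (1 : ℝ) < N := lt_of_le_of_lt (le_max_left _ _) hN
  have hN1 : 1 < N := by exact_mod_cast hN1r
  have hn1 : 1 ≤ n := le_trans hN1.le hn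
  have hm : 2 ^ n - 1 ≠ 0 := by
    have := Nat.one_lt_two_pow (show n ≠ 0 by omega)
    omega
  have hv1 : 1 ≤ padicValNat p (2 ^ n - 1) :=
    (padicValNat_dvd_iff_le hm).mp (by simpa using hpd)
  by_contra hne
  have hv2 : 2 ≤ padicValNat p (2 ^ n - 1) := by omega
  have hmain := hK n (by omega) p hp
  -- (v-1) log p ≥ log p > δ n log 2
  have hp1 : (1 : ℝ) < p := by exact_mod_cast hp.one_lt
  have hlogp : 0 < Real.log p := Real.log_pos hp1
  have hlogp_gt : δ * n * Real.log 2 < Real.log p := by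
    have := Real.log_lt_log (by positivity) hbig
    rwa [Real.log_rpow (by norm_num)] at this
  have hcast : (1 : ℝ) ≤ ((padicValNat p (2 ^ n - 1) - 1 : ℕ) : ℝ) := by
    have : 1 ≤ padicValNat p (2 ^ n - 1) - 1 := by omega
    exact_mod_cast this
  have h3 : Real.log p ≤ ((padicValNat p (2 ^ n - 1) - 1 : ℕ) : ℝ) * Real.log p := by
    nlinarith
  -- K < (δ/2) N log 2 ≤ (δ/2) n log 2
  have hKlt : K < δ / 2 * Real.log 2 * N := by
    have : K / (δ / 2 * Real.log 2) < N := lt_of_le_of_lt (le_max_right _ _) hN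
    rw [div_lt_iff₀ (by positivity)] at this
    linarith
  have hNn : (N : ℝ) ≤ n := by exact_mod_cast hn
  have : δ / 2 * Real.log 2 * N ≤ δ / 2 * Real.log 2 * n := by gcongr
  nlinarith [hmain, h3, hlogp_gt, hKlt, this]

end Summit.ABC.ABC.Theorems
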